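import Literature.Computability.QuantumComplexity.ZXCalculusPiCopy
import HarnessLib

/-!
# `ZX_{π/4}` modulo the calculus: JPV Lemma 7 at every angle, (B2) in ladder form, JPV Lemma 10, and the square lemma for (C1)

Topic `Literature/Computability/QuantumComplexity`, continuing `ZXCalculusPiCopy.lean`: layers A17, A18, D1, D4 of the
formalisation of `JeandelPerdrixVilmart2018_completeness`, merged into one module. Four parts, each with its own header
below: (A17) JPV Lemma 7 at every angle (`dumbbell_zero_eq`), (K1) at arity 0, (K) colour-swapped; (A18) red bends and the
bialgebra rule (B2) in ladder/CNOT layout (`rule_B2_cnot`); (D1) **JPV Lemma 10** (a red `π/2` pair around a green node: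
`X_halfpis_seq_Z_merge`); (D4) the Hadamard-edge gadget and JPV's "lemma for the equivalence (C1)"
(`xsplits_hWire_eq_square`). [cite: JeandelPerdrixVilmart2018, Appendix Lemmas 7, 10 and Lemma C1]
-/

/-! ## Part: `ZXCalculusAngleDeleteAll.lean` -/
/-!
# `ZX_{π/4}` modulo the calculus: the `π` phase at arity zero; JPV Lemma 7 at every angle

Topic `Literature/Computability/QuantumComplexity`, continuing `ZXCalculusPiCopy.lean` (layer A17
of the formalisation of `JeandelPerdrixVilmart2018_completeness`).

* **(K1) at arity zero**: the red phase-free state absorbs the green `π` phase,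
  `X^{(0,1)}(0) ⨾ Z^{(1,1)}(π) = X^{(0,1)}(0)` (`X_state_seq_Z_phase_pi`), with its flip and colour
  swap (`Z_phase_pi_seq_X_effect`, `X_phase_pi_seq_Z_effect`, `Z_state_seq_X_phase_pi`), and (K1)
  in red (`K1_red`);
* **JPV Lemma 7 (bicolour `0`–`α`) at EVERY angle**: the scalar `X^{(0,1)}(0) ⨾ Z^{(1,0)}(α)` does
  not depend on `α` (`dumbbell_zero_eq`), following Backens–Perdrix–Wang's `alphadelete`
  derivation — (S1), (IV), (K), (K1), (B1) — with JPV's exact scalars: with one `√2`,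
  `√2 ⊗ (X^{(0,1)}(0) ⨾ Z^{(1,0)}(α))` equals `(X^{(0,1)}(π) ⨾ Z^{(1,0)}(α)) ⊗ (X^{(0,1)}(π) ⨾ Z^{(1,0)}(-α))`
  by (K) and (K1) at arity zero, which (B1) and (K1) merge into `√2 ⊗ (X^{(0,1)}(π) ⨾ Z^{(1,0)}(0))`;
  the angle `π` is then deleted by the Clifford case, and `√2` cancels.

## References

* E. Jeandel, S. Perdrix, R. Vilmart, LICS 2018 (arXiv:1705.11151v2), Appendix Lemmas 4 and 7
  [JeandelPerdrixVilmart2018].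
* M. Backens, S. Perdrix, Q. Wang, *A simplified stabilizer ZX-calculus*, QPL 2016
  (arXiv:1602.04744), §"Minimality", Lemma `alphadelete` and its proof figure.
-/

noncomputable section

namespace Literature.Computability.QuantumComplexity

open ZXDiagram ZXClass

namespace ZXClass

/-! ### Cancelling `√2` in front of states and on the left of scalars -/

/-- `√2` cancels in front of states on one wire. [cite: JeandelPerdrixVilmart2018, Appendix Lemma 5] -/
theorem cancel_sqrt_two_state {A B : ZXClass 0 1} (h : mk (dumbbell 0 0) ⊠ A = mk (dumbbell 0 0) ⊠ B) : A = B := by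
  have h' : (mk (dumbbell 0 0) ⊠ A) ⊠ mk invSqrtTwo = (mk (dumbbell 0 0) ⊠ B) ⊠ mk invSqrtTwo :=
    congrArg (· ⊠ mk invSqrtTwo) h
  rwa [par_assoc, cast_id, par_assoc, cast_id, ← scalar_par_state_comm (mk invSqrtTwo) A,
    ← scalar_par_state_comm (mk invSqrtTwo) B, par_assoc', cast_id, par_assoc', cast_id,
    scalar_par_comm _ (mk invSqrtTwo), invSqrtTwo_par_dumbbell, empty_par, cast_id, empty_par, cast_id] at h'

/-- `√2` cancels on the left of scalars. [cite: JeandelPerdrixVilmart2018, Appendix Lemma 5] -/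
theorem cancel_sqrt_two_left_scalar {s t : ZXClass 0 0} (h : mk (dumbbell 0 0) ⊠ s = mk (dumbbell 0 0) ⊠ t) : s = t := by
  rw [scalar_par_comm _ s, scalar_par_comm _ t] at h
  exact cancel_sqrt_two h

/-- A scalar attached to a state on two wires stays in front when an effect-like map is appended. [folklore] -/
theorem scalar_par_state_two_seq_one (s : ZXClass 0 0) (A : ZXClass 0 2) (B : ZXClass 2 1) :
    (s ⊠ A) ⨟ B = s ⊠ (A ⨟ B) := by
  rw [scalar_par_seq_left, empty_par, cast_id]

/-- A scalar attached to a state on two wires stays in front when a scalar-valued map is appended. [folklore] -/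
theorem scalar_par_state_two_seq_zero (s : ZXClass 0 0) (A : ZXClass 0 2) (B : ZXClass 2 0) :
    (s ⊠ A) ⨟ B = s ⊠ (A ⨟ B) := by
  rw [scalar_par_seq_left, empty_par, cast_id]

/-! ### (K1) at arity zero -/

/-- **(K1) at arity zero, state form**: the red phase-free state absorbs the green `π` phase,
`X^{(0,1)}(0) ⨾ Z^{(1,1)}(π) = X^{(0,1)}(0)` — un-fuse the phase as a `π` effect on a split, copy
the red state (B1), delete the angle `π` of the closed-off copy (Lemma 7 at `π`), cancel `√2`.
[cite: JeandelPerdrixVilmart2018, Appendix Lemmas 4, 7] -/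
theorem X_state_seq_Z_phase_pi : mk (X 0 1 0) ⨟ mk (Z 1 1 4) = mk (X 0 1 0) := by
  have hZ : mk (Z 1 1 4) = mk (Z 1 2 0) ⨟ (mk (Z 1 0 4) ⊠ mk (wires 1)) := by
    rw [Z_seq_Z_par 1 1 1 0 le_rfl, add_zero (4 : ZMod 8)]
  apply cancel_sqrt_two_state
  rw [hZ, ← seq_assoc, ← scalar_par_state_two_seq_one, rule_B1, interchange, seq_id,
    show mk (X 0 1 0) ⨟ mk (Z 1 0 4) = mk (dumbbell 0 4) from rfl, dumbbell_zero_four]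

/-- **(K1) at arity zero**: `Z^{(1,1)}(π) ⨾ X^{(1,0)}(0) = X^{(1,0)}(0)`. [cite: JeandelPerdrixVilmart2018, Appendix Lemma 4] -/
theorem Z_phase_pi_seq_X_effect : mk (Z 1 1 4) ⨟ mk (X 1 0 0) = mk (X 1 0 0) := by
  have h := congrArg transpose X_state_seq_Z_phase_pi
  simpa using h

/-- (K1) at arity zero, colours swapped: `X^{(1,1)}(π) ⨾ Z^{(1,0)}(0) = Z^{(1,0)}(0)`. [cite: JeandelPerdrixVilmart2018, Appendix Lemma 4] -/
theorem X_phase_pi_seq_Z_effect : mk (X 1 1 4) ⨟ mk (Z 1 0 0) = mk (Z 1 0 0) := by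
  have h := congrArg colorSwap Z_phase_pi_seq_X_effect
  simpa using h

/-- (K1) at arity zero, colours swapped, state form: `Z^{(0,1)}(0) ⨾ X^{(1,1)}(π) = Z^{(0,1)}(0)`. [cite: JeandelPerdrixVilmart2018, Appendix Lemma 4] -/
theorem Z_state_seq_X_phase_pi : mk (Z 0 1 0) ⨟ mk (X 1 1 4) = mk (Z 0 1 0) := by
  have h := congrArg colorSwap X_state_seq_Z_phase_pi
  simpa using h

/-- **(K1) in red**: `X^{(1,1)}(π) ⨾ Z^{(1,2)} = Z^{(1,2)} ⨾ (X^{(1,1)}(π) ⊗ X^{(1,1)}(π))`. [cite: JeandelPerdrixVilmart2018, Appendix Lemma 4] -/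
theorem K1_red : mk (X 1 1 4) ⨟ mk (Z 1 2 0) = mk (Z 1 2 0) ⨟ (mk (X 1 1 4) ⊠ mk (X 1 1 4)) := by
  have h := congrArg colorSwap K1
  simpa using h

/-! ### Lemma 7 at every angle -/

/-- Rule (K), flipped and colour-swapped: `√2 ⊗ (X^{(1,1)}(π) ⨾ Z^{(1,1)}(α)) =
(X^{(0,1)}(π) ⨾ Z^{(1,0)}(α)) ⊗ (Z^{(1,1)}(-α) ⨾ X^{(1,1)}(π))`. [cite: JeandelPerdrixVilmart2018, Fig. 1 (K)] -/
theorem rule_K_red (a : ZMod 8) : mk (dumbbell 0 0) ⊠ (mk (X 1 1 4) ⨟ mk (Z 1 1 a)) =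
    mk (dumbbell 4 a) ⊠ (mk (Z 1 1 (-a)) ⨟ mk (X 1 1 4)) := by
  have h := congrArg transpose (congrArg colorSwap (rule_K a))
  simpa using h

/-- The angle `π` on the red side is deleted too: `X^{(0,1)}(π) ⨾ Z^{(1,0)}(0) = √2`. [cite: JeandelPerdrixVilmart2018, Appendix Lemma 7] -/
theorem dumbbell_four_zero : mk (dumbbell 4 0) = mk (dumbbell 0 0) := by
  have h := congrArg colorSwap dumbbell_zero_four
  simpa using h

/-- With one `√2`, the bicolour scalar `X^{(0,1)}(0) ⨾ Z^{(1,0)}(α)` splits into the two scalars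
`X^{(0,1)}(π) ⨾ Z^{(1,0)}(±α)` (rule (K) and (K1) at arity zero). [cite: JeandelPerdrixVilmart2018, Appendix Lemma 7] -/
theorem sqrt_two_par_dumbbell_zero (a : ZMod 8) :
    mk (dumbbell 0 0) ⊠ mk (dumbbell 0 a) = mk (dumbbell 4 a) ⊠ mk (dumbbell 4 (-a)) := by
  have hX : mk (X 0 1 0) = mk (X 0 1 4) ⨟ mk (X 1 1 4) := by
    rw [X_seq_X 0 1 1 le_rfl, show (4 : ZMod 8) + 4 = 0 from by decide]
  have hZ : mk (Z 1 0 a) = mk (Z 1 1 a) ⨟ mk (Z 1 0 0) := by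
    rw [Z_seq_Z 1 1 0 le_rfl, add_zero a]
  calc mk (dumbbell 0 0) ⊠ mk (dumbbell 0 a)
      = mk (dumbbell 0 0) ⊠ (mk (X 0 1 4) ⨟ (mk (X 1 1 4) ⨟ mk (Z 1 1 a)) ⨟ mk (Z 1 0 0)) := by
        rw [show mk (dumbbell 0 a) = mk (X 0 1 0) ⨟ mk (Z 1 0 a) from rfl, hX, hZ, seq_assoc, ← seq_assoc (mk (X 1 1 4)),
          ← seq_assoc]
    _ = mk (X 0 1 4) ⨟ (mk (dumbbell 4 a) ⊠ (mk (Z 1 1 (-a)) ⨟ mk (X 1 1 4))) ⨟ mk (Z 1 0 0) := by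
        rw [← rule_K_red, ← scalar_par_state_seq_effect, ← state_seq_scalar_par]
    _ = mk (dumbbell 4 a) ⊠ (mk (X 0 1 4) ⨟ mk (Z 1 0 (-a))) := by
        rw [state_seq_scalar_par, scalar_par_state_seq_effect, seq_assoc, seq_assoc, X_phase_pi_seq_Z_effect,
          Z_seq_Z 1 1 0 le_rfl, add_zero (-a)]
    _ = mk (dumbbell 4 a) ⊠ mk (dumbbell 4 (-a)) := rfl

/-- **JPV Lemma 7 (bicolour `0`–`α`) at every angle**: `X^{(0,1)}(0) ⨾ Z^{(1,0)}(α) = X^{(0,1)}(0) ⨾ Z^{(1,0)}(0)`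
(`= √2`). [cite: JeandelPerdrixVilmart2018, Appendix Lemma 7] -/
theorem dumbbell_zero_eq (a : ZMod 8) : mk (dumbbell 0 a) = mk (dumbbell 0 0) := by
  apply cancel_sqrt_two_left_scalar
  -- both `X^{(0,1)}(π) ⨾ Z^{(1,0)}(±α)` are `X^{(0,1)}(0) ⨾ X^{(1,1)}(π) ⨾ Z^{(1,0)}(±α)`: (B1) merges the
  -- two red states, (K1) brings the two `π` phases together, the angles cancel
  have hX4 : mk (X 0 1 4) = mk (X 0 1 0) ⨟ mk (X 1 1 4) := by
    rw [X_seq_X 0 1 1 le_rfl, zero_add]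
  have hd : ∀ b : ZMod 8, mk (dumbbell 4 b) = mk (X 0 1 0) ⨟ (mk (X 1 1 4) ⨟ mk (Z 1 0 b)) := fun b => by
    rw [show mk (dumbbell 4 b) = mk (X 0 1 4) ⨟ mk (Z 1 0 b) from rfl, hX4, seq_assoc]
  have hsplit : mk (Z 1 2 0) ⨟ (mk (Z 1 0 a) ⊠ mk (Z 1 0 (-a))) = mk (Z 1 0 0) := by
    rw [par_eq_seq_left (mk (Z 1 0 a)) (mk (Z 1 0 (-a))), empty_par, cast_id, ← seq_assoc,
      Z_seq_Z_par 1 1 1 0 le_rfl, add_zero a, Z_seq_Z 1 1 0 le_rfl, add_neg_cancel]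
  rw [sqrt_two_par_dumbbell_zero, hd a, hd (-a), ← interchange, ← rule_B1, scalar_par_state_two_seq_zero,
    seq_assoc, ← interchange (mk (X 1 1 4)) (mk (Z 1 0 a)) (mk (X 1 1 4)) (mk (Z 1 0 (-a))), ← seq_assoc (mk (Z 1 2 0)),
    ← K1_red, ← seq_assoc, ← seq_assoc, ← hX4, seq_assoc, hsplit, show mk (X 0 1 4) ⨟ mk (Z 1 0 0) = mk (dumbbell 4 0) from rfl,
    dumbbell_four_zero]

/-- Hence, in state/effect words: `Z^{(0,1)}(α) ⨾ X^{(1,0)}(0) = Z^{(0,1)}(0) ⨾ X^{(1,0)}(0)`. [cite: JeandelPerdrixVilmart2018, Appendix Lemma 7] -/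
theorem Z_state_seq_X_effect (a : ZMod 8) : mk (Z 0 1 a) ⨟ mk (X 1 0 0) = mk (Z 0 1 0) ⨟ mk (X 1 0 0) := by
  rw [← dumbbell_symm, ← dumbbell_symm, dumbbell_zero_eq]

/-- And any angle on the red side is deleted by the green effect as well: `X^{(0,1)}(α) ⨾ Z^{(1,0)}(0) = √2`.
[cite: JeandelPerdrixVilmart2018, Appendix Lemma 7] -/
theorem dumbbell_eq_zero (a : ZMod 8) : mk (dumbbell a 0) = mk (dumbbell 0 0) := by
  have h := congrArg colorSwap (dumbbell_zero_eq a)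
  simpa using h

end ZXClass

end Literature.Computability.QuantumComplexity


/-! ## Part: `ZXCalculusLadder.lean` -/
/-!
# `ZX_{π/4}` modulo the calculus: the bialgebra rule in ladder (CNOT) layout

Topic `Literature/Computability/QuantumComplexity`, continuing `ZXCalculusAngleDeleteAll.lean`
(layer A18 of the formalisation of `JeandelPerdrixVilmart2018_completeness`).

* red bends and the three-legged spiders in the layouts used below, the yanking of a cup leg that
  crosses one wire (`cup_par_seq_swap_seq_par_cap`);
* **(B2) in ladder (CNOT) layout** (`rule_B2_cnot`): a green split whose second output enters a
  red merge, `(Z^{(1,2)} ⊗ 𝕀) ⨾ (𝕀 ⊗ X^{(2,1)})`, is `√2 ⊗` the ladder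
  `((X^{(1,2)} ⊗ 𝕀) ⨾ (𝕀 ⊗ Z^{(2,1)})) ⨾ σ ⨾ ((X^{(1,2)} ⊗ 𝕀) ⨾ (𝕀 ⊗ Z^{(2,1)}))` — rule (B2) bent by
  a cup and a cap (`split_par_seq_par_xmerge_bent`), its red states and green effects fused
  (`bent_bialgebra_eq`), and the snake yanked straight through the crossing
  (`ladder_eq_bent_bialgebra`). This is the layout in which (B2) is applied inside graph-like
  diagrams whose two nodes both carry an input and an output (JPV Lemmas 10–12).

## References

* E. Jeandel, S. Perdrix, R. Vilmart, LICS 2018 (arXiv:1705.11151v2), Fig. 1 (B2) and §2.2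
  [JeandelPerdrixVilmart2018].
* B. Coecke, R. Duncan, New J. Phys. 13 (2011), §9 (bialgebra law) [CoeckeDuncan2011].
-/

noncomputable section

namespace Literature.Computability.QuantumComplexity

open ZXDiagram ZXClass

namespace ZXClass

/-! ### Red bends and three-legged spiders -/

/-- `X^{(0,3)} = η ⨾ (X^{(1,2)} ⊗ 𝕀)`. [folklore] -/
theorem X_zero_three_eq_cup_xsplit_par : mk (X 0 3 0) = mk cup ⨟ (mk (X 1 2 0) ⊠ mk (wires 1)) := by
  have h := congrArg colorSwap Z_zero_three_eq_cup_split_par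
  simpa using h

/-- `X^{(0,3)} = η ⨾ (𝕀 ⊗ X^{(1,2)})`. [folklore] -/
theorem X_zero_three_eq_cup_par_xsplit : mk (X 0 3 0) = mk cup ⨟ (mk (wires 1) ⊠ mk (X 1 2 0)) := by
  have h := congrArg colorSwap Z_zero_three_eq_cup_par_split
  simpa using h

/-- Bending the second output of the red split into an input: `(X^{(1,2)} ⊗ 𝕀) ⨾ (𝕀 ⊗ ε) = X^{(2,1)}`. [cite: JeandelPerdrixVilmart2018, §2.2] -/
theorem xsplit_par_seq_par_cap : (mk (X 1 2 0) ⊠ mk (wires 1)) ⨟ (mk (wires 1) ⊠ mk cap) = mk (X 2 1 0) := by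
  have h := congrArg colorSwap split_par_seq_par_cap
  simpa using h

/-- `Z^{(3,0)} = (𝕀 ⊗ Z^{(2,1)}) ⨾ ε`. [folklore] -/
theorem Z_three_zero_eq_par_merge_cap : mk (Z 3 0 0) = (mk (wires 1) ⊠ mk (Z 2 1 0)) ⨟ mk cap := by
  rw [← Z_two_zero, par_Z_seq_Z 1 2 1 0 le_rfl, add_zero (0 : ZMod 8)]

/-- `Z^{(3,0)} = (Z^{(2,1)} ⊗ 𝕀) ⨾ ε`. [folklore] -/
theorem Z_three_zero_eq_merge_par_cap : mk (Z 3 0 0) = (mk (Z 2 1 0) ⊠ mk (wires 1)) ⨟ mk cap := by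
  rw [← Z_two_zero, Z_par_seq_Z 2 1 1 0 le_rfl, add_zero (0 : ZMod 8)]

/-- **Yanking a cup leg that crosses one wire**: `(η ⊗ 𝕀²) ⨾ (𝕀 ⊗ σ ⊗ 𝕀) ⨾ (𝕀² ⊗ ε) = σ`. [cite: JeandelPerdrixVilmart2018, §2.2] -/
theorem cup_par_seq_swap_seq_par_cap :
    (mk cup ⊠ mk (wires 2)) ⨟ ((mk (wires 1) ⊠ mk swap) ⊠ mk (wires 1)) ⨟ (mk (wires 2) ⊠ mk cap) = mk swap := by
  have e1 : mk cup ⊠ mk (wires 2) = (mk cup ⊠ mk (wires 1)) ⊠ mk (wires 1) := by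
    rw [← wires_par_wires 1 1]; exact (par_assoc' _ _ _).trans (cast_id _ _ _)
  have e2 : (mk (wires 1) ⊠ mk cup) ⊠ mk (wires 1) = mk (wires 1) ⊠ (mk cup ⊠ mk (wires 1)) :=
    (par_assoc _ _ _).trans (cast_id _ _ _)
  have e3 : mk (wires 2) ⊠ mk cap = mk (wires 1) ⊠ (mk (wires 1) ⊠ mk cap) := by
    rw [← wires_par_wires 1 1]; exact (par_assoc _ _ _).trans (cast_id _ _ _)
  have e4 : (mk swap ⊠ mk (wires 1)) ⊠ mk (wires 1) = mk swap ⊠ mk (wires 2) := by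
    rw [← wires_par_wires 1 1]; exact (par_assoc _ _ _).trans (cast_id _ _ _)
  rw [e1, interchange, cup_par_seq_par_swap, id_seq, seq_par_wires, seq_assoc, e4, ← par_eq_seq_left,
    par_eq_seq_right (mk swap) (mk cap), par_empty, ← seq_assoc, e2, e3, ← wires_par_seq, snake_right,
    wires_par_wires, id_seq]

/-! ### The bialgebra rule in ladder layout -/

/-- A green split whose second output enters a red merge, bent: a cup on the left and a cap on the
right turn the connecting wire vertical. [cite: JeandelPerdrixVilmart2018, §2.2] -/
theorem split_par_seq_par_xmerge_bent :
    (mk (Z 1 2 0) ⊠ mk (wires 1)) ⨟ (mk (wires 1) ⊠ mk (X 2 1 0)) =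
      ((mk cup ⊠ mk (wires 1)) ⊠ mk (wires 1)) ⨟ ((mk (wires 1) ⊠ (mk (Z 2 1 0) ⨟ mk (X 1 2 0))) ⊠ mk (wires 1)) ⨟
        (mk (wires 1) ⊠ (mk (wires 1) ⊠ mk cap)) := by
  have e : (mk (wires 1) ⊠ mk (X 1 2 0)) ⊠ mk (wires 1) = mk (wires 1) ⊠ (mk (X 1 2 0) ⊠ mk (wires 1)) :=
    (par_assoc _ _ _).trans (cast_id _ _ _)
  rw [wires_par_seq, seq_par_wires, ← seq_assoc, interchange, spider_bend, id_seq, seq_assoc, e,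
    interchange (mk (wires 1)) (mk (wires 1)) (mk (X 1 2 0) ⊠ mk (wires 1)) (mk (wires 1) ⊠ mk cap), id_seq,
    xsplit_par_seq_par_cap]

/-- A scalar inside `𝕀 ⊗ · ⊗ 𝕀` (arities `2 → 2` inside) comes out in front. [folklore] -/
theorem wires_par_scalar_par_par_wires (s : ZXClass 0 0) (E : ZXClass 2 2) :
    (mk (wires 1) ⊠ (s ⊠ E)) ⊠ mk (wires 1) = s ⊠ ((mk (wires 1) ⊠ E) ⊠ mk (wires 1)) := by
  have e1 : mk (wires 1) ⊠ (s ⊠ E) = (mk (wires 1) ⊠ s) ⊠ E := (par_assoc' _ _ _).trans (cast_id _ _ _)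
  have e2 : (s ⊠ mk (wires 1)) ⊠ E = s ⊠ (mk (wires 1) ⊠ E) := (par_assoc _ _ _).trans (cast_id _ _ _)
  rw [e1, ← scalar_par_wires, e2]
  exact (par_assoc _ _ _).trans (cast_id _ _ _)

/-- A scalar passes a `2 → 4` map into the map after it. [folklore] -/
theorem two_four_seq_scalar_par_four (A : ZXClass 2 4) (s : ZXClass 0 0) (B : ZXClass 4 4) :
    A ⨟ (s ⊠ B) = s ⊠ (A ⨟ B) := by
  rw [scalar_par_seq_right, empty_par, cast_id]

/-- A scalar attached to a `2 → 4` map stays in front when a map to two wires is appended. [folklore] -/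
theorem scalar_par_two_four_seq_two (s : ZXClass 0 0) (A : ZXClass 2 4) (B : ZXClass 4 2) :
    (s ⊠ A) ⨟ B = s ⊠ (A ⨟ B) := by
  rw [scalar_par_seq_left, empty_par, cast_id]

/-- **(B2) bent**: `(Z^{(1,2)} ⊗ 𝕀) ⨾ (𝕀 ⊗ X^{(2,1)})` is `√2 ⊗` the bialgebra pattern closed by
the cup and the cap. [cite: JeandelPerdrixVilmart2018, Fig. 1 (B2)] -/
theorem split_par_seq_par_xmerge_eq_sqrt_two_par :
    (mk (Z 1 2 0) ⊠ mk (wires 1)) ⨟ (mk (wires 1) ⊠ mk (X 2 1 0)) =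
      mk (dumbbell 0 0) ⊠ (((mk cup ⊠ mk (wires 1)) ⊠ mk (wires 1)) ⨟
        ((mk (wires 1) ⊠ ((mk (X 1 2 0) ⊠ mk (X 1 2 0)) ⨟ ((mk (wires 1) ⊠ mk swap) ⊠ mk (wires 1)) ⨟
          (mk (Z 2 1 0) ⊠ mk (Z 2 1 0)))) ⊠ mk (wires 1)) ⨟ (mk (wires 1) ⊠ (mk (wires 1) ⊠ mk cap))) := by
  rw [split_par_seq_par_xmerge_bent, ← rule_B2_red, wires_par_scalar_par_par_wires, two_four_seq_scalar_par_four,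
    scalar_par_two_four_seq_two]

/-- The bent bialgebra pattern with its red states and green effects fused:
`(X^{(0,3)} ⊗ X^{(1,2)} ⊗ 𝕀) ⨾ (𝕀² ⊗ σ ⊗ 𝕀²) ⨾ (𝕀 ⊗ Z^{(2,1)} ⊗ Z^{(3,0)})`. [cite: JeandelPerdrixVilmart2018, Fig. 1 (S1)] -/
theorem bent_bialgebra_eq :
    ((mk cup ⊠ mk (wires 1)) ⊠ mk (wires 1)) ⨟
        ((mk (wires 1) ⊠ ((mk (X 1 2 0) ⊠ mk (X 1 2 0)) ⨟ ((mk (wires 1) ⊠ mk swap) ⊠ mk (wires 1)) ⨟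
          (mk (Z 2 1 0) ⊠ mk (Z 2 1 0)))) ⊠ mk (wires 1)) ⨟ (mk (wires 1) ⊠ (mk (wires 1) ⊠ mk cap)) =
      ((mk (X 0 3 0) ⊠ mk (X 1 2 0)) ⊠ mk (wires 1)) ⨟ ((mk (wires 1) ⊠ ((mk (wires 1) ⊠ mk swap) ⊠ mk (wires 1))) ⊠ mk (wires 1)) ⨟
        ((mk (wires 1) ⊠ mk (Z 2 1 0)) ⊠ mk (Z 3 0 0)) := by
  have eX : mk (wires 1) ⊠ (mk (X 1 2 0) ⊠ mk (X 1 2 0)) = (mk (wires 1) ⊠ mk (X 1 2 0)) ⊠ mk (X 1 2 0) :=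
    (par_assoc' _ _ _).trans (cast_id _ _ _)
  have eZ : (mk (wires 1) ⊠ (mk (Z 2 1 0) ⊠ mk (Z 2 1 0))) ⊠ mk (wires 1) =
      (mk (wires 1) ⊠ mk (Z 2 1 0)) ⊠ (mk (Z 2 1 0) ⊠ mk (wires 1)) := by
    rw [show mk (wires 1) ⊠ (mk (Z 2 1 0) ⊠ mk (Z 2 1 0)) = (mk (wires 1) ⊠ mk (Z 2 1 0)) ⊠ mk (Z 2 1 0) from
      (par_assoc' _ _ _).trans (cast_id _ _ _)]
    exact (par_assoc _ _ _).trans (cast_id _ _ _)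
  have eC : mk (wires 1) ⊠ (mk (wires 1) ⊠ mk cap) = mk (wires 2) ⊠ mk cap := by
    rw [← wires_par_wires 1 1]; exact (par_assoc' _ _ _).trans (cast_id _ _ _)
  have hbot : ((mk cup ⊠ mk (wires 1)) ⊠ mk (wires 1)) ⨟ ((mk (wires 1) ⊠ (mk (X 1 2 0) ⊠ mk (X 1 2 0))) ⊠ mk (wires 1)) =
      (mk (X 0 3 0) ⊠ mk (X 1 2 0)) ⊠ mk (wires 1) := by
    rw [eX, interchange, interchange, ← X_zero_three_eq_cup_par_xsplit, id_seq, id_seq]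
  have htop : ((mk (wires 1) ⊠ (mk (Z 2 1 0) ⊠ mk (Z 2 1 0))) ⊠ mk (wires 1)) ⨟ (mk (wires 1) ⊠ (mk (wires 1) ⊠ mk cap)) =
      (mk (wires 1) ⊠ mk (Z 2 1 0)) ⊠ mk (Z 3 0 0) := by
    rw [eZ, eC, interchange, seq_id, ← Z_three_zero_eq_merge_par_cap]
  rw [one_par_seq_seq_par_one, ← seq_assoc, ← seq_assoc,
    seq_assoc _ ((mk (wires 1) ⊠ (mk (Z 2 1 0) ⊠ mk (Z 2 1 0))) ⊠ mk (wires 1)) (mk (wires 1) ⊠ (mk (wires 1) ⊠ mk cap)),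
    hbot, htop]

/-- A `2 → 2` map followed by a cup on its left is the cup next to the map. [folklore] -/
theorem seq_cup_par (A : ZXClass 2 2) : A ⨟ (mk cup ⊠ mk (wires 2)) = mk cup ⊠ A := by
  rw [par_eq_seq_right (mk cup) A, empty_par, cast_id]

/-- A cap on the right followed by a `2 → 2` map is the map next to the cap. [folklore] -/
theorem par_cap_seq (A : ZXClass 2 2) : (mk (wires 2) ⊠ mk cap) ⨟ A = A ⊠ mk cap := by
  rw [par_eq_seq_right A (mk cap), par_empty]

/-- A cup next to a composite. [folklore] -/
theorem cup_par_seq (P : ZXClass 2 3) (Q : ZXClass 3 2) : mk cup ⊠ (P ⨟ Q) = (mk cup ⊠ P) ⨟ (mk (wires 2) ⊠ Q) := by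
  rw [interchange, seq_id]

/-- A composite next to a cap. [folklore] -/
theorem seq_par_cap (P : ZXClass 2 3) (Q : ZXClass 3 2) : (P ⨟ Q) ⊠ mk cap = (P ⊠ mk (wires 2)) ⨟ (Q ⊠ mk cap) := by
  rw [interchange, id_seq]

/-- Layer bookkeeping for the ladder: the green merge on the right passes the crossing. [folklore] -/
theorem wires_par_merge_seq_swap_layer :
    (mk (wires 2) ⊠ (mk (wires 1) ⊠ mk (Z 2 1 0))) ⨟ ((mk (wires 1) ⊠ mk swap) ⊠ mk (wires 1)) =
      ((mk (wires 1) ⊠ mk swap) ⊠ mk (wires 2)) ⨟ (mk (wires 3) ⊠ mk (Z 2 1 0)) := by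
  have e : mk (wires 2) ⊠ (mk (wires 1) ⊠ mk (Z 2 1 0)) = mk (wires 3) ⊠ mk (Z 2 1 0) := by
    rw [← wires_par_wires 2 1]; exact (par_assoc' _ _ _).trans (cast_id _ _ _)
  rw [e, interchange, id_seq, seq_id, ← par_eq_seq_left]

/-- Layer bookkeeping for the ladder: the green merge on the right passes the red split on the left. [folklore] -/
theorem wires_par_merge_seq_xsplit_layer :
    (mk (wires 3) ⊠ mk (Z 2 1 0)) ⨟ ((mk (X 1 2 0) ⊠ mk (wires 1)) ⊠ mk (wires 2)) =
      (mk (X 1 2 0) ⊠ mk (wires 4)) ⨟ (mk (wires 4) ⊠ mk (Z 2 1 0)) := by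
  have e1 : mk (wires 3) ⊠ mk (Z 2 1 0) = mk (wires 1) ⊠ (mk (wires 2) ⊠ mk (Z 2 1 0)) := by
    rw [← wires_par_wires 1 2]; exact (par_assoc _ _ _).trans (cast_id _ _ _)
  have e2 : (mk (X 1 2 0) ⊠ mk (wires 1)) ⊠ mk (wires 2) = mk (X 1 2 0) ⊠ mk (wires 3) := by
    rw [← wires_par_wires 1 2]; exact (par_assoc _ _ _).trans (cast_id _ _ _)
  have e3 : mk (wires 4) ⊠ mk (Z 2 1 0) = mk (wires 2) ⊠ (mk (wires 2) ⊠ mk (Z 2 1 0)) := by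
    rw [← wires_par_wires 2 2]; exact (par_assoc _ _ _).trans (cast_id _ _ _)
  rw [e1, e2, interchange, id_seq, seq_id, e3, interchange, seq_id, id_seq]

/-- Layer bookkeeping for the ladder: the red split on the left passes the crossing. [folklore] -/
theorem par_swap_seq_xsplit_layer :
    ((mk (wires 1) ⊠ mk swap) ⊠ mk (wires 2)) ⨟ (mk (X 1 2 0) ⊠ mk (wires 4)) =
      (mk (X 1 2 0) ⊠ mk (wires 4)) ⨟ ((mk (wires 2) ⊠ mk swap) ⊠ mk (wires 2)) := by
  have e1 : (mk (wires 1) ⊠ mk swap) ⊠ mk (wires 2) = mk (wires 1) ⊠ (mk swap ⊠ mk (wires 2)) :=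
    (par_assoc _ _ _).trans (cast_id _ _ _)
  have e2 : (mk (wires 2) ⊠ mk swap) ⊠ mk (wires 2) = mk (wires 2) ⊠ (mk swap ⊠ mk (wires 2)) :=
    (par_assoc _ _ _).trans (cast_id _ _ _)
  rw [e1, interchange, id_seq, seq_id, e2, interchange, seq_id, id_seq]

/-- Layer bookkeeping for the ladder: the green merge on the right closes the cap into `Z^{(3,0)}`. [cite: JeandelPerdrixVilmart2018, Fig. 1 (S1)] -/
theorem wires_par_merge_seq_top_layer :
    (mk (wires 4) ⊠ mk (Z 2 1 0)) ⨟ ((mk (wires 1) ⊠ mk (Z 2 1 0)) ⊠ mk cap) = (mk (wires 1) ⊠ mk (Z 2 1 0)) ⊠ mk (Z 3 0 0) := by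
  have e : mk (wires 4) ⊠ mk (Z 2 1 0) = mk (wires 3) ⊠ (mk (wires 1) ⊠ mk (Z 2 1 0)) := by
    rw [← wires_par_wires 3 1]; exact (par_assoc _ _ _).trans (cast_id _ _ _)
  rw [e, interchange, id_seq, ← Z_three_zero_eq_par_merge_cap]

/-- Layer bookkeeping for the ladder: the cup feeding the left red split makes it `X^{(0,3)}`. [cite: JeandelPerdrixVilmart2018, Fig. 1 (S1)] -/
theorem cup_par_xsplit_seq_bottom_layer :
    (mk cup ⊠ (mk (X 1 2 0) ⊠ mk (wires 1))) ⨟ (mk (X 1 2 0) ⊠ mk (wires 4)) = (mk (X 0 3 0) ⊠ mk (X 1 2 0)) ⊠ mk (wires 1) := by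
  have e1 : mk (X 1 2 0) ⊠ mk (wires 4) = (mk (X 1 2 0) ⊠ mk (wires 1)) ⊠ mk (wires 3) := by
    rw [← wires_par_wires 1 3]; exact (par_assoc' _ _ _).trans (cast_id _ _ _)
  have e2 : mk (X 0 3 0) ⊠ (mk (X 1 2 0) ⊠ mk (wires 1)) = (mk (X 0 3 0) ⊠ mk (X 1 2 0)) ⊠ mk (wires 1) :=
    (par_assoc' _ _ _).trans (cast_id _ _ _)
  rw [e1, interchange, ← X_zero_three_eq_cup_xsplit_par, seq_id, e2]

/-- Regrouping of the middle crossing of six wires. [folklore] -/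
theorem wires_two_par_swap_par_wires_two :
    (mk (wires 2) ⊠ mk swap) ⊠ mk (wires 2) = (mk (wires 1) ⊠ ((mk (wires 1) ⊠ mk swap) ⊠ mk (wires 1))) ⊠ mk (wires 1) := by
  rw [← wires_par_wires 1 1, show (mk (wires 1) ⊠ mk (wires 1)) ⊠ mk swap = mk (wires 1) ⊠ (mk (wires 1) ⊠ mk swap)
      from (par_assoc _ _ _).trans (cast_id _ _ _),
    show (mk (wires 1) ⊠ (mk (wires 1) ⊠ mk swap)) ⊠ (mk (wires 1) ⊠ mk (wires 1)) =
      ((mk (wires 1) ⊠ (mk (wires 1) ⊠ mk swap)) ⊠ mk (wires 1)) ⊠ mk (wires 1) from (par_assoc' _ _ _).trans (cast_id _ _ _),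
    show (mk (wires 1) ⊠ (mk (wires 1) ⊠ mk swap)) ⊠ mk (wires 1) = mk (wires 1) ⊠ ((mk (wires 1) ⊠ mk swap) ⊠ mk (wires 1))
      from (par_assoc _ _ _).trans (cast_id _ _ _)]

/-- **The ladder is the bent bialgebra pattern yanked straight.** [cite: JeandelPerdrixVilmart2018, §2.2] -/
theorem ladder_eq_bent_bialgebra :
    ((mk (X 1 2 0) ⊠ mk (wires 1)) ⨟ (mk (wires 1) ⊠ mk (Z 2 1 0))) ⨟ mk swap ⨟
        ((mk (X 1 2 0) ⊠ mk (wires 1)) ⨟ (mk (wires 1) ⊠ mk (Z 2 1 0))) =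
      ((mk (X 0 3 0) ⊠ mk (X 1 2 0)) ⊠ mk (wires 1)) ⨟ ((mk (wires 1) ⊠ ((mk (wires 1) ⊠ mk swap) ⊠ mk (wires 1))) ⊠ mk (wires 1)) ⨟
        ((mk (wires 1) ⊠ mk (Z 2 1 0)) ⊠ mk (Z 3 0 0)) := by
  conv_lhs => rw [← cup_par_seq_swap_seq_par_cap]
  rw [← seq_assoc ((mk (X 1 2 0) ⊠ mk (wires 1)) ⨟ (mk (wires 1) ⊠ mk (Z 2 1 0))),
    ← seq_assoc ((mk (X 1 2 0) ⊠ mk (wires 1)) ⨟ (mk (wires 1) ⊠ mk (Z 2 1 0))), seq_cup_par,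
    seq_assoc _ (mk (wires 2) ⊠ mk cap), par_cap_seq, cup_par_seq, seq_par_cap,
    seq_assoc (mk cup ⊠ (mk (X 1 2 0) ⊠ mk (wires 1))), wires_par_merge_seq_swap_layer, ← seq_assoc, ← seq_assoc,
    seq_assoc _ (mk (wires 3) ⊠ mk (Z 2 1 0)), wires_par_merge_seq_xsplit_layer, ← seq_assoc,
    seq_assoc _ (mk (wires 4) ⊠ mk (Z 2 1 0)), wires_par_merge_seq_top_layer,
    seq_assoc (mk cup ⊠ (mk (X 1 2 0) ⊠ mk (wires 1))), par_swap_seq_xsplit_layer, ← seq_assoc,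
    cup_par_xsplit_seq_bottom_layer, wires_two_par_swap_par_wires_two]

/-- **(B2) in ladder (CNOT) layout**: `(Z^{(1,2)} ⊗ 𝕀) ⨾ (𝕀 ⊗ X^{(2,1)}) =
√2 ⊗ (((X^{(1,2)} ⊗ 𝕀) ⨾ (𝕀 ⊗ Z^{(2,1)})) ⨾ σ ⨾ ((X^{(1,2)} ⊗ 𝕀) ⨾ (𝕀 ⊗ Z^{(2,1)})))`.
[cite: JeandelPerdrixVilmart2018, Fig. 1 (B2)] -/
theorem rule_B2_cnot :
    (mk (Z 1 2 0) ⊠ mk (wires 1)) ⨟ (mk (wires 1) ⊠ mk (X 2 1 0)) =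
      mk (dumbbell 0 0) ⊠ (((mk (X 1 2 0) ⊠ mk (wires 1)) ⨟ (mk (wires 1) ⊠ mk (Z 2 1 0))) ⨟ mk swap ⨟
        ((mk (X 1 2 0) ⊠ mk (wires 1)) ⨟ (mk (wires 1) ⊠ mk (Z 2 1 0)))) := by
  rw [split_par_seq_par_xmerge_eq_sqrt_two_par, bent_bialgebra_eq, ladder_eq_bent_bialgebra]

end ZXClass

end Literature.Computability.QuantumComplexity


/-! ## Part: `ZXCalculusLocalComp.lean` -/
/-!
# `ZX_{π/4}` modulo the calculus: JPV Lemma 10 (two red `π/2` around a green node)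

Topic `Literature/Computability/QuantumComplexity`, continuing `ZXCalculusLadder.lean` (layer D.1
of the formalisation of `JeandelPerdrixVilmart2018_completeness`): the first of the graph-state
identities that JPV obtain "by completeness of the π/2-fragment", derived in the term calculus.

* the colour-swapped Euler rule bent by a cap (`xhalfpis_seq_merge_seq_xeffect`): the red
  `π/2 – [green node closed by the red -π/2 effect] – π/2` path is a Hadamard wire;
* **JPV Lemma 10** (`X_halfpis_seq_Z_merge`):
  `(X(π/2) ⊗ X(π/2)) ⨾ Z^{(2,1)} = √2 ⊗ ((Z^{(1,2)} ⨾ (H ⊗ H) ⊗ 𝕀) ⨾ (𝕀 ⊗ Z^{(2,1)}) ⨾ (𝕀 ⊗ H) ⨾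
  Z^{(2,1)}(π) ⨾ X(π/2))` — the right-hand side is JPV's triangle: the two inputs enter green
  vertices joined by a Hadamard wire, both joined by Hadamard wires to a green `π` vertex whose
  remaining leg leaves through `X(π/2)` (drawn without crossings). Derivation following the figure
  shipped with the LICS sources (`lemma-red-pi_2-around-green-node-proof`): un-fuse
  `X(-π/2) ⨾ X(π/2)` below the merge, bialgebra (B2), the bent Euler rule, colour change of one
  red split, bialgebra in ladder layout (`rule_B2_cnot`), colour change of the upper rung, and the
  parallel pair of `ZXCalculusHadamardWires` gives the `π` (`sqrt_two_par_rung_seq_hBox_merge`).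

## References

* E. Jeandel, S. Perdrix, R. Vilmart, LICS 2018 (arXiv:1705.11151v2), Appendix Lemma 10 and the
  proof figure `lemma-red-pi_2-around-green-node-proof` of its sources [JeandelPerdrixVilmart2018].
* R. Duncan, S. Perdrix, *Graph states and the necessity of Euler decomposition*, CiE 2009
  (local complementation from the Euler rule).
-/

noncomputable section

namespace Literature.Computability.QuantumComplexity

open ZXDiagram ZXClass

namespace ZXClass

/-! ### JPV Lemma 10: two red `π/2` around a green node -/

/-- Bending the first output of the red split into an input with a cap on the left:
`(𝕀 ⊗ X^{(1,2)}) ⨾ (ε ⊗ 𝕀) = X^{(2,1)}`. [cite: JeandelPerdrixVilmart2018, §2.2] -/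
theorem par_xsplit_seq_cap_par : (mk (wires 1) ⊠ mk (X 1 2 0)) ⨟ (mk cap ⊠ mk (wires 1)) = mk (X 2 1 0) := by
  have h := congrArg colorSwap (congrArg transpose spider_bend)
  simpa using h

/-- The crossing before a cap on the left is the other crossing before a cap on the right. [folklore] -/
theorem par_swap_seq_cap_par :
    (mk (wires 1) ⊠ mk swap) ⨟ (mk cap ⊠ mk (wires 1)) = (mk swap ⊠ mk (wires 1)) ⨟ (mk (wires 1) ⊠ mk cap) := by
  have h := congrArg transpose cup_par_seq_par_swap
  simpa using h

/-- Capping wires 3 and 4 after crossing 2 and 3 is capping 2 and 3 after crossing 3 and 4. [folklore] -/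
theorem par_swap_par_seq_wires_par_cap :
    ((mk (wires 1) ⊠ mk swap) ⊠ mk (wires 1)) ⨟ (mk (wires 2) ⊠ mk cap) =
      (mk (wires 2) ⊠ mk swap) ⨟ ((mk (wires 1) ⊠ mk cap) ⊠ mk (wires 1)) := by
  have e1 : (mk (wires 1) ⊠ mk swap) ⊠ mk (wires 1) = mk (wires 1) ⊠ (mk swap ⊠ mk (wires 1)) :=
    (par_assoc _ _ _).trans (cast_id _ _ _)
  have e2 : mk (wires 2) ⊠ mk cap = mk (wires 1) ⊠ (mk (wires 1) ⊠ mk cap) := by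
    rw [← wires_par_wires 1 1]; exact (par_assoc _ _ _).trans (cast_id _ _ _)
  have e3 : mk (wires 2) ⊠ mk swap = mk (wires 1) ⊠ (mk (wires 1) ⊠ mk swap) := by
    rw [← wires_par_wires 1 1]; exact (par_assoc _ _ _).trans (cast_id _ _ _)
  have e4 : (mk (wires 1) ⊠ mk cap) ⊠ mk (wires 1) = mk (wires 1) ⊠ (mk cap ⊠ mk (wires 1)) :=
    (par_assoc _ _ _).trans (cast_id _ _ _)
  rw [e1, e2, ← wires_par_seq, e3, e4, ← wires_par_seq, par_swap_seq_cap_par]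

/-- A state and a `1 → 1` map, crossed: `(s ⊗ A) ⨾ σ = A ⊗ s`. [folklore] -/
theorem state_par_seq_swap (s : ZXClass 0 1) (A : ZXClass 1 1) : (s ⊠ A) ⨟ mk swap = A ⊠ s := by
  have hs : (s ⊠ mk (wires 1)) ⨟ mk swap = mk (wires 1) ⊠ s := by simpa using swap_nat s
  have hA : (mk (wires 1) ⊠ A) ⨟ mk swap = mk swap ⨟ (A ⊠ mk (wires 1)) := by simpa using (fswap1_nat A).symm
  rw [par_eq_seq_left s A, seq_assoc, hA, ← seq_assoc, hs, ← par_eq_seq_right]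

/-- **The Euler rule, colour-swapped and bent**: the red `π/2 – [green node closed by the red
`-π/2` effect] – π/2` path is a Hadamard wire: `(X(π/2) ⊗ X(π/2)) ⨾ Z^{(2,1)} ⨾ X^{(1,0)}(-π/2) = (H ⊗ 𝕀) ⨾ ε`.
[cite: JeandelPerdrixVilmart2018, Fig. 1 (EU)] -/
theorem xhalfpis_seq_merge_seq_xeffect :
    ((mk (X 1 1 2) ⊠ mk (X 1 1 2)) ⨟ mk (Z 2 1 0)) ⨟ mk (X 1 0 (-2)) = (mk hBox ⊠ mk (wires 1)) ⨟ mk cap := by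
  have hEU : mk hBox = (mk (X 1 1 2) ⊠ mk (X 0 1 (-2))) ⨟ mk (Z 2 1 0) ⨟ mk (X 1 1 2) := by
    simpa using congrArg colorSwap rule_EU
  have hxc : (mk (X 1 1 2) ⊠ mk (wires 1)) ⨟ mk cap = (mk (wires 1) ⊠ mk (X 1 1 2)) ⨟ mk cap :=
    (par_xphase_seq_cap 2).symm
  -- both sides are `(X(π/2) ⊗ X^{(0,1)}(-π/2) ⊗ X(π/2)) ⨾ Z^{(3,0)}` up to the symmetry of `Z^{(3,0)}`
  have hsym : (mk (wires 1) ⊠ mk swap) ⨟ mk (Z 3 0 0) = mk (Z 3 0 0) := by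
    rw [Z_three_zero_eq_par_merge_cap, ← seq_assoc, ← wires_par_seq, swap_spider]
  have e1 : (mk (X 1 1 2) ⊠ mk (X 1 1 2)) ⊠ mk (X 0 1 (-2)) = mk (X 1 1 2) ⊠ (mk (X 1 1 2) ⊠ mk (X 0 1 (-2))) :=
    (par_assoc _ _ _).trans (cast_id _ _ _)
  have e2 : (mk (X 1 1 2) ⊠ mk (X 0 1 (-2))) ⊠ mk (X 1 1 2) = mk (X 1 1 2) ⊠ (mk (X 0 1 (-2)) ⊠ mk (X 1 1 2)) :=
    (par_assoc _ _ _).trans (cast_id _ _ _)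
  have hL : ((mk (X 1 1 2) ⊠ mk (X 1 1 2)) ⨟ mk (Z 2 1 0)) ⨟ mk (X 1 0 (-2)) =
      (mk (X 1 1 2) ⊠ (mk (X 1 1 2) ⊠ mk (X 0 1 (-2)))) ⨟ mk (Z 3 0 0) := by
    rw [← par_xstate_seq_cap (-2), ← seq_assoc, show ((mk (X 1 1 2) ⊠ mk (X 1 1 2)) ⨟ mk (Z 2 1 0)) ⨟
      (mk (wires 1) ⊠ mk (X 0 1 (-2))) = ((mk (X 1 1 2) ⊠ mk (X 1 1 2)) ⨟ mk (Z 2 1 0)) ⊠ mk (X 0 1 (-2)) from by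
        rw [par_eq_seq_left (_ ⨟ mk (Z 2 1 0)) (mk (X 0 1 (-2))), par_empty],
      show ((mk (X 1 1 2) ⊠ mk (X 1 1 2)) ⨟ mk (Z 2 1 0)) ⊠ mk (X 0 1 (-2)) =
        ((mk (X 1 1 2) ⊠ mk (X 1 1 2)) ⊠ mk (X 0 1 (-2))) ⨟ (mk (Z 2 1 0) ⊠ mk (wires 1)) from by rw [interchange, seq_id],
      seq_assoc, ← Z_three_zero_eq_merge_par_cap, e1]
  have hR : (mk hBox ⊠ mk (wires 1)) ⨟ mk cap = (mk (X 1 1 2) ⊠ (mk (X 0 1 (-2)) ⊠ mk (X 1 1 2))) ⨟ mk (Z 3 0 0) := by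
    rw [hEU, seq_par_wires, seq_assoc, hxc, ← seq_assoc, show (((mk (X 1 1 2) ⊠ mk (X 0 1 (-2))) ⨟ mk (Z 2 1 0)) ⊠
      mk (wires 1)) ⨟ (mk (wires 1) ⊠ mk (X 1 1 2)) = ((mk (X 1 1 2) ⊠ mk (X 0 1 (-2))) ⊠ mk (X 1 1 2)) ⨟
        (mk (Z 2 1 0) ⊠ mk (wires 1)) from by rw [interchange, interchange, id_seq, seq_id, seq_id],
      seq_assoc, ← Z_three_zero_eq_merge_par_cap, e2]
  rw [hL, hR]
  conv_lhs => rw [← hsym, ← seq_assoc, interchange, seq_id, par_state_seq_swap]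

/-- A scalar passes a `2 → 2` map into a map after it (to two wires). [folklore] -/
theorem two_two_seq_scalar_par_two (A : ZXClass 2 2) (s : ZXClass 0 0) (B : ZXClass 2 2) :
    A ⨟ (s ⊠ B) = s ⊠ (A ⨟ B) := by
  rw [scalar_par_seq_right, empty_par, cast_id]

/-- A scalar passes a `2 → 2` map into a map after it (to one wire). [folklore] -/
theorem two_two_seq_scalar_par_one (A : ZXClass 2 2) (s : ZXClass 0 0) (B : ZXClass 2 1) :
    A ⨟ (s ⊠ B) = s ⊠ (A ⨟ B) := by
  rw [scalar_par_seq_right, empty_par, cast_id]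

/-- A scalar in front of a `2 → 2` map stays in front when a map to one wire is appended. [folklore] -/
theorem scalar_par_two_two_seq_one (s : ZXClass 0 0) (A : ZXClass 2 2) (B : ZXClass 2 1) :
    (s ⊠ A) ⨟ B = s ⊠ (A ⨟ B) := by
  rw [scalar_par_seq_left, empty_par, cast_id]

/-- A scalar in front of a `2 → 1` map stays in front when a `1 → 1` map is appended. [folklore] -/
theorem scalar_par_two_one_seq_one (s : ZXClass 0 0) (A : ZXClass 2 1) (B : ZXClass 1 1) :
    (s ⊠ A) ⨟ B = s ⊠ (A ⨟ B) := by
  rw [scalar_par_seq_left, empty_par, cast_id]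

/-- Red `π/2` phases on the second outputs of two red splits cross the middle crossing. [folklore] -/
theorem par_xhalfpis_seq_par_swap_par :
    ((mk (wires 1) ⊠ mk (X 1 1 2)) ⊠ (mk (wires 1) ⊠ mk (X 1 1 2))) ⨟ ((mk (wires 1) ⊠ mk swap) ⊠ mk (wires 1)) =
      ((mk (wires 1) ⊠ mk swap) ⊠ mk (wires 1)) ⨟ (mk (wires 2) ⊠ (mk (X 1 1 2) ⊠ mk (X 1 1 2))) := by
  have hsw : (mk (X 1 1 2) ⊠ mk (wires 1)) ⨟ mk swap = mk swap ⨟ (mk (wires 1) ⊠ mk (X 1 1 2)) := by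
    simpa using swap_nat (mk (X 1 1 2))
  have eL : (mk (wires 1) ⊠ mk (X 1 1 2)) ⊠ (mk (wires 1) ⊠ mk (X 1 1 2)) = (mk (wires 1) ⊠ (mk (X 1 1 2) ⊠ mk (wires 1))) ⊠ mk (X 1 1 2) := by
    rw [show (mk (wires 1) ⊠ mk (X 1 1 2)) ⊠ (mk (wires 1) ⊠ mk (X 1 1 2)) = ((mk (wires 1) ⊠ mk (X 1 1 2)) ⊠ mk (wires 1)) ⊠ mk (X 1 1 2)
      from (par_assoc' _ _ _).trans (cast_id _ _ _), show (mk (wires 1) ⊠ mk (X 1 1 2)) ⊠ mk (wires 1) =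
      mk (wires 1) ⊠ (mk (X 1 1 2) ⊠ mk (wires 1)) from (par_assoc _ _ _).trans (cast_id _ _ _)]
  have eR : mk (wires 2) ⊠ (mk (X 1 1 2) ⊠ mk (X 1 1 2)) = (mk (wires 1) ⊠ (mk (wires 1) ⊠ mk (X 1 1 2))) ⊠ mk (X 1 1 2) := by
    rw [← wires_par_wires 1 1, show (mk (wires 1) ⊠ mk (wires 1)) ⊠ (mk (X 1 1 2) ⊠ mk (X 1 1 2)) =
      ((mk (wires 1) ⊠ mk (wires 1)) ⊠ mk (X 1 1 2)) ⊠ mk (X 1 1 2) from (par_assoc' _ _ _).trans (cast_id _ _ _),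
      show (mk (wires 1) ⊠ mk (wires 1)) ⊠ mk (X 1 1 2) = mk (wires 1) ⊠ (mk (wires 1) ⊠ mk (X 1 1 2))
      from (par_assoc _ _ _).trans (cast_id _ _ _)]
  rw [eL, interchange, ← wires_par_seq, hsw, wires_par_seq, seq_id]
  conv_rhs => rw [eR, interchange, id_seq]

/-- Two Hadamard boxes on the outputs of the left split cross the middle crossing. [folklore] -/
theorem hBoxes_par_seq_par_swap_par :
    ((mk hBox ⊠ mk hBox) ⊠ mk (wires 2)) ⨟ ((mk (wires 1) ⊠ mk swap) ⊠ mk (wires 1)) =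
      ((mk (wires 1) ⊠ mk swap) ⊠ mk (wires 1)) ⨟ ((mk hBox ⊠ mk (wires 1)) ⊠ (mk hBox ⊠ mk (wires 1))) := by
  have hsw : (mk hBox ⊠ mk (wires 1)) ⨟ mk swap = mk swap ⨟ (mk (wires 1) ⊠ mk hBox) := by
    simpa using swap_nat (mk hBox)
  have eL : (mk hBox ⊠ mk hBox) ⊠ mk (wires 2) = (mk hBox ⊠ (mk hBox ⊠ mk (wires 1))) ⊠ mk (wires 1) := by
    rw [← wires_par_wires 1 1, show (mk hBox ⊠ mk hBox) ⊠ (mk (wires 1) ⊠ mk (wires 1)) =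
      ((mk hBox ⊠ mk hBox) ⊠ mk (wires 1)) ⊠ mk (wires 1) from (par_assoc' _ _ _).trans (cast_id _ _ _),
      show (mk hBox ⊠ mk hBox) ⊠ mk (wires 1) = mk hBox ⊠ (mk hBox ⊠ mk (wires 1)) from (par_assoc _ _ _).trans (cast_id _ _ _)]
  have eR : (mk hBox ⊠ mk (wires 1)) ⊠ (mk hBox ⊠ mk (wires 1)) = (mk hBox ⊠ (mk (wires 1) ⊠ mk hBox)) ⊠ mk (wires 1) := by
    rw [show (mk hBox ⊠ mk (wires 1)) ⊠ (mk hBox ⊠ mk (wires 1)) = ((mk hBox ⊠ mk (wires 1)) ⊠ mk hBox) ⊠ mk (wires 1)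
      from (par_assoc' _ _ _).trans (cast_id _ _ _), show (mk hBox ⊠ mk (wires 1)) ⊠ mk hBox =
      mk hBox ⊠ (mk (wires 1) ⊠ mk hBox) from (par_assoc _ _ _).trans (cast_id _ _ _)]
  rw [eL, interchange, interchange (mk hBox) (mk (wires 1)) (mk hBox ⊠ mk (wires 1)) (mk swap), hsw, seq_id, seq_id]
  conv_rhs => rw [eR, interchange, interchange (mk (wires 1)) (mk hBox) (mk swap) (mk (wires 1) ⊠ mk hBox), id_seq, id_seq]

/-- **JPV Lemma 10, first half**: un-fuse `X(-π/2) ⨾ X(π/2)` below the merge, bialgebra, and the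
bent Euler rule: `(X(π/2) ⊗ X(π/2)) ⨾ Z^{(2,1)} = √2 ⊗ ((X^{(1,2)} ⊗ X^{(1,2)}) ⨾ (𝕀 ⊗ σ ⊗ 𝕀) ⨾
(Z^{(2,1)} ⊗ ((H ⊗ 𝕀) ⨾ ε)) ⨾ X(π/2))` — two red splits joined by a Hadamard wire.
[cite: JeandelPerdrixVilmart2018, Appendix Lemma 10] -/
theorem xhalfpis_seq_merge_eq_bialgebra :
    (mk (X 1 1 2) ⊠ mk (X 1 1 2)) ⨟ mk (Z 2 1 0) =
      mk (dumbbell 0 0) ⊠ (((mk (X 1 2 0) ⊠ mk (X 1 2 0)) ⨟ ((mk (wires 1) ⊠ mk swap) ⊠ mk (wires 1))) ⨟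
        (mk (Z 2 1 0) ⊠ ((mk hBox ⊠ mk (wires 1)) ⨟ mk cap)) ⨟ mk (X 1 1 2)) := by
  have hins : mk (Z 2 1 0) = mk (Z 2 1 0) ⨟ (mk (X 1 2 0) ⨟ (mk (wires 1) ⊠ mk (X 1 0 (-2)))) ⨟ mk (X 1 1 2) := by
    rw [X_seq_par_X 1 1 1 0 le_rfl, zero_add, seq_assoc, xphase_seq_xphase, neg_add_cancel, X_one_one, seq_id]
  have hph : mk (X 1 1 2) ⨟ mk (X 1 2 0) = mk (X 1 2 0) ⨟ (mk (wires 1) ⊠ mk (X 1 1 2)) := by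
    rw [X_seq_X 1 1 2 le_rfl, X_seq_par_X 1 1 1 1 le_rfl, add_zero (2 : ZMod 8), zero_add (2 : ZMod 8)]
  conv_lhs => rw [hins]
  rw [← seq_assoc (mk (Z 2 1 0)), ← rule_B2_red, ← seq_assoc, ← seq_assoc, two_two_seq_scalar_par_two,
    scalar_par_two_two_seq_one, scalar_par_two_one_seq_one]
  congr 1
  rw [← seq_assoc, ← seq_assoc, interchange (mk (X 1 1 2)) (mk (X 1 2 0)) (mk (X 1 1 2)) (mk (X 1 2 0)), hph,
    ← interchange, seq_assoc (mk (X 1 2 0) ⊠ mk (X 1 2 0)), par_xhalfpis_seq_par_swap_par,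
    ← seq_assoc (mk (X 1 2 0) ⊠ mk (X 1 2 0)), seq_assoc _ (mk (wires 2) ⊠ (mk (X 1 1 2) ⊠ mk (X 1 1 2))),
    interchange (mk (wires 2)) (mk (Z 2 1 0)), id_seq, seq_assoc _ _ (mk (wires 1) ⊠ mk (X 1 0 (-2))),
    interchange (mk (Z 2 1 0)) (mk (wires 1)), seq_id, xhalfpis_seq_merge_seq_xeffect]

/-- **JPV Lemma 10, second half, up to the ladder**: colour change of the left red split and the
Hadamard wire straightened into the red merge of a CNOT:
`= √2 ⊗ ((H ⊗ 𝕀) ⨾ (Z^{(1,2)} ⊗ 𝕀) ⨾ (𝕀 ⊗ X^{(2,1)}) ⨾ ((H ⊗ 𝕀) ⨾ Z^{(2,1)}) ⨾ X(π/2))`.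
[cite: JeandelPerdrixVilmart2018, Appendix Lemma 10] -/
theorem xhalfpis_seq_merge_eq_cnot :
    (mk (X 1 1 2) ⊠ mk (X 1 1 2)) ⨟ mk (Z 2 1 0) =
      mk (dumbbell 0 0) ⊠ ((mk hBox ⊠ mk (wires 1)) ⨟ ((mk (Z 1 2 0) ⊠ mk (wires 1)) ⨟ (mk (wires 1) ⊠ mk (X 2 1 0))) ⨟
        ((mk hBox ⊠ mk (wires 1)) ⨟ mk (Z 2 1 0)) ⨟ mk (X 1 1 2)) := by
  have hX : mk (X 1 2 0) ⊠ mk (X 1 2 0) = (mk hBox ⊠ mk (wires 1)) ⨟ (mk (Z 1 2 0) ⊠ mk (X 1 2 0)) ⨟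
      ((mk hBox ⊠ mk hBox) ⊠ mk (wires 2)) := by
    rw [← interchange_left, ← X_split_eq 0]
  have hHH : (mk hBox ⊠ mk (wires 1)) ⨟ ((mk hBox ⊠ mk (wires 1)) ⨟ mk cap) = mk cap := by
    rw [← seq_assoc, interchange, hBox_seq_hBox, id_seq, wires_par_wires, id_seq]
  have hW : ((mk hBox ⊠ mk (wires 1)) ⨟ mk (Z 2 1 0)) ⊠ mk cap =
      (mk (wires 2) ⊠ mk cap) ⨟ ((mk hBox ⊠ mk (wires 1)) ⨟ mk (Z 2 1 0)) := by
    rw [par_eq_seq_right (_ ⨟ mk (Z 2 1 0)) (mk cap), par_empty]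
  have e1 : mk (wires 2) ⊠ mk (X 1 2 0) = mk (wires 1) ⊠ (mk (wires 1) ⊠ mk (X 1 2 0)) := by
    rw [← wires_par_wires 1 1]; exact (par_assoc _ _ _).trans (cast_id _ _ _)
  have e2 : (mk (wires 1) ⊠ mk cap) ⊠ mk (wires 1) = mk (wires 1) ⊠ (mk cap ⊠ mk (wires 1)) :=
    (par_assoc _ _ _).trans (cast_id _ _ _)
  calc (mk (X 1 1 2) ⊠ mk (X 1 1 2)) ⨟ mk (Z 2 1 0)
      = mk (dumbbell 0 0) ⊠ (((mk (X 1 2 0) ⊠ mk (X 1 2 0)) ⨟ ((mk (wires 1) ⊠ mk swap) ⊠ mk (wires 1))) ⨟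
          (mk (Z 2 1 0) ⊠ ((mk hBox ⊠ mk (wires 1)) ⨟ mk cap)) ⨟ mk (X 1 1 2)) := xhalfpis_seq_merge_eq_bialgebra
    _ = mk (dumbbell 0 0) ⊠ (((((mk hBox ⊠ mk (wires 1)) ⨟ (mk (Z 1 2 0) ⊠ mk (X 1 2 0))) ⨟ ((mk (wires 1) ⊠ mk swap) ⊠ mk (wires 1))) ⨟
          (((mk hBox ⊠ mk (wires 1)) ⊠ (mk hBox ⊠ mk (wires 1))) ⨟ (mk (Z 2 1 0) ⊠ ((mk hBox ⊠ mk (wires 1)) ⨟ mk cap)))) ⨟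
            mk (X 1 1 2)) := by
        rw [hX, seq_assoc _ ((mk hBox ⊠ mk hBox) ⊠ mk (wires 2)) ((mk (wires 1) ⊠ mk swap) ⊠ mk (wires 1)),
          hBoxes_par_seq_par_swap_par, ← seq_assoc _ ((mk (wires 1) ⊠ mk swap) ⊠ mk (wires 1)),
          seq_assoc _ ((mk hBox ⊠ mk (wires 1)) ⊠ (mk hBox ⊠ mk (wires 1)))]
    _ = mk (dumbbell 0 0) ⊠ (((((mk hBox ⊠ mk (wires 1)) ⨟ (mk (Z 1 2 0) ⊠ mk (X 1 2 0))) ⨟ ((mk (wires 1) ⊠ mk swap) ⊠ mk (wires 1))) ⨟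
          ((mk (wires 2) ⊠ mk cap) ⨟ ((mk hBox ⊠ mk (wires 1)) ⨟ mk (Z 2 1 0)))) ⨟ mk (X 1 1 2)) := by
        rw [interchange (mk hBox ⊠ mk (wires 1)) (mk (Z 2 1 0)) (mk hBox ⊠ mk (wires 1)) ((mk hBox ⊠ mk (wires 1)) ⨟ mk cap),
          hHH, hW]
    _ = mk (dumbbell 0 0) ⊠ (((((mk hBox ⊠ mk (wires 1)) ⨟ (mk (Z 1 2 0) ⊠ mk (X 1 2 0))) ⨟
          ((mk (wires 2) ⊠ mk swap) ⨟ ((mk (wires 1) ⊠ mk cap) ⊠ mk (wires 1)))) ⨟ ((mk hBox ⊠ mk (wires 1)) ⨟ mk (Z 2 1 0))) ⨟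
            mk (X 1 1 2)) := by
        rw [← seq_assoc _ (mk (wires 2) ⊠ mk cap) ((mk hBox ⊠ mk (wires 1)) ⨟ mk (Z 2 1 0)),
          seq_assoc _ ((mk (wires 1) ⊠ mk swap) ⊠ mk (wires 1)) (mk (wires 2) ⊠ mk cap), par_swap_par_seq_wires_par_cap]
    _ = mk (dumbbell 0 0) ⊠ ((mk hBox ⊠ mk (wires 1)) ⨟ ((mk (Z 1 2 0) ⊠ mk (wires 1)) ⨟ (mk (wires 1) ⊠ mk (X 2 1 0))) ⨟
          ((mk hBox ⊠ mk (wires 1)) ⨟ mk (Z 2 1 0)) ⨟ mk (X 1 1 2)) := by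
        rw [par_eq_seq_left (mk (Z 1 2 0)) (mk (X 1 2 0)),
          seq_assoc (mk hBox ⊠ mk (wires 1)) ((mk (Z 1 2 0) ⊠ mk (wires 1)) ⨟ (mk (wires 2) ⊠ mk (X 1 2 0))),
          seq_assoc (mk (Z 1 2 0) ⊠ mk (wires 1)) (mk (wires 2) ⊠ mk (X 1 2 0)),
          ← seq_assoc (mk (wires 2) ⊠ mk (X 1 2 0)) (mk (wires 2) ⊠ mk swap), ← wires_par_seq 2 (mk (X 1 2 0)) (mk swap),
          X_seq_swap, e1, e2, ← wires_par_seq, par_xsplit_seq_cap_par]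
where
  /-- `(H ⨾ Z^{(1,2)} ⨾ (H ⊗ H)) ⊗ X^{(1,2)}` layered. [folklore] -/
  interchange_left : (mk hBox ⨟ mk (Z 1 2 0) ⨟ (mk hBox ⊠ mk hBox)) ⊠ mk (X 1 2 0) =
      (mk hBox ⊠ mk (wires 1)) ⨟ (mk (Z 1 2 0) ⊠ mk (X 1 2 0)) ⨟ ((mk hBox ⊠ mk hBox) ⊠ mk (wires 2)) := by
    rw [interchange, interchange, id_seq, seq_id]

/-- The upper rung of the ladder after the colour change of its red split, closed by the final
merge: with one `√2`, the parallel pair of `ZXCalculusHadamardWires` makes it the `π` merge —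
`√2 ⊗ (((X^{(1,2)} ⊗ 𝕀) ⨾ (𝕀 ⊗ Z^{(2,1)})) ⨾ ((H ⊗ 𝕀) ⨾ Z^{(2,1)})) = (H ⊗ 𝕀) ⨾ Z^{(2,1)}(π)`.
[cite: JeandelPerdrixVilmart2018, Appendix Lemmas 9, 10] -/
theorem sqrt_two_par_rung_seq_hBox_merge :
    mk (dumbbell 0 0) ⊠ (((mk (X 1 2 0) ⊠ mk (wires 1)) ⨟ (mk (wires 1) ⊠ mk (Z 2 1 0))) ⨟ ((mk hBox ⊠ mk (wires 1)) ⨟ mk (Z 2 1 0))) =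
      (mk hBox ⊠ mk (wires 1)) ⨟ mk (Z 2 1 4) := by
  have hXH : mk (X 1 2 0) ⨟ (mk hBox ⊠ mk (wires 1)) = mk hBox ⨟ (mk (Z 1 2 0) ⨟ (mk (wires 1) ⊠ mk hBox)) := by
    rw [X_split_eq, seq_assoc, seq_assoc, interchange, hBox_seq_hBox, seq_id]
  have eH : mk hBox ⊠ mk (wires 2) = (mk hBox ⊠ mk (wires 1)) ⊠ mk (wires 1) := by
    rw [← wires_par_wires 1 1]; exact (par_assoc' _ _ _).trans (cast_id _ _ _)
  have eP : mk (dumbbell 0 0) ⊠ ((mk (Z 1 2 0) ⨟ (mk (wires 1) ⊠ mk hBox) ⨟ mk (Z 2 1 0)) ⊠ mk (wires 1)) =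
      (mk (dumbbell 0 0) ⊠ (mk (Z 1 2 0) ⨟ (mk (wires 1) ⊠ mk hBox) ⨟ mk (Z 2 1 0))) ⊠ mk (wires 1) :=
    (par_assoc' _ _ _).trans (cast_id _ _ _)
  rw [seq_assoc, ← seq_assoc (mk (wires 1) ⊠ mk (Z 2 1 0)), interchange (mk (wires 1)) (mk hBox) (mk (Z 2 1 0)) (mk (wires 1)),
    id_seq, seq_id, par_eq_seq_left (mk hBox) (mk (Z 2 1 0)), seq_assoc, ← Z_three_one_eq_par_merge_merge,
    Z_three_one_eq_merge_par_merge, ← seq_assoc, ← seq_assoc, eH, ← seq_par_wires, hXH, seq_par_wires, seq_assoc,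
    seq_assoc, ← seq_assoc ((mk (Z 1 2 0) ⨟ (mk (wires 1) ⊠ mk hBox)) ⊠ mk (wires 1)), ← seq_par_wires,
    ← one_two'', ← scalar_par_two_two_seq_one, eP, sqrt_two_par_split_par_hBox_merge, Z_par_seq_Z 1 1 1 1 le_rfl,
    add_zero (4 : ZMod 8)]
where
  /-- A scalar passes `H ⊗ 𝕀` into the map after it (to one wire). [folklore] -/
  one_two'' (B : ZXClass 2 1) : (mk hBox ⊠ mk (wires 1)) ⨟ (mk (dumbbell 0 0) ⊠ B) = mk (dumbbell 0 0) ⊠ ((mk hBox ⊠ mk (wires 1)) ⨟ B) := by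
    rw [scalar_par_seq_right, empty_par, cast_id]

/-- **JPV Lemma 10** (two red `π/2` around a green node): `(X(π/2) ⊗ X(π/2)) ⨾ Z^{(2,1)} =
√2 ⊗ ((Z^{(1,2)} ⨾ (H ⊗ H) ⊗ 𝕀) ⨾ (𝕀 ⊗ Z^{(2,1)}) ⨾ (𝕀 ⊗ H) ⨾ Z^{(2,1)}(π) ⨾ X(π/2))` — on the right,
JPV's triangle: the first input enters a green vertex `u`, the second a green vertex `v`, `u –H– v`,
`u –H– c`, `v –H– c` for the green `π` vertex `c`, whose remaining leg leaves through `X(π/2)`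
(the figure's layout redrawn without crossings: `v` merges the input with the Hadamard leg of `u`,
its output is the Hadamard leg to `c`). [cite: JeandelPerdrixVilmart2018, Appendix Lemma 10] -/
theorem X_halfpis_seq_Z_merge :
    (mk (X 1 1 2) ⊠ mk (X 1 1 2)) ⨟ mk (Z 2 1 0) =
      mk (dumbbell 0 0) ⊠ (((mk (Z 1 2 0) ⨟ (mk hBox ⊠ mk hBox)) ⊠ mk (wires 1)) ⨟ (mk (wires 1) ⊠ mk (Z 2 1 0)) ⨟
        (mk (wires 1) ⊠ mk hBox) ⨟ mk (Z 2 1 4) ⨟ mk (X 1 1 2)) := by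
  have hsH : mk swap ⨟ (mk hBox ⊠ mk (wires 1)) = (mk (wires 1) ⊠ mk hBox) ⨟ mk swap := by
    simpa using fswap1_nat (mk hBox)
  rw [xhalfpis_seq_merge_eq_cnot, rule_B2_cnot, two_two_seq_scalar_par_two, scalar_par_two_two_seq_one,
    scalar_par_two_one_seq_one]
  -- `√2 ⊗ √2 ⊗ (((H ⊗ 𝕀) ⨾ ladder) ⨾ ((H ⊗ 𝕀) ⨾ Z^{(2,1)}) ⨾ X(π/2))`: the inner `√2` goes to the upper rung
  rw [← seq_assoc (mk hBox ⊠ mk (wires 1)), ← seq_assoc (mk hBox ⊠ mk (wires 1)),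
    seq_assoc _ ((mk (X 1 2 0) ⊠ mk (wires 1)) ⨟ (mk (wires 1) ⊠ mk (Z 2 1 0))) ((mk hBox ⊠ mk (wires 1)) ⨟ mk (Z 2 1 0)),
    ← scalar_par_two_one_seq_one, ← two_two_seq_scalar_par_one, sqrt_two_par_rung_seq_hBox_merge,
    seq_assoc ((mk hBox ⊠ mk (wires 1)) ⨟ _) (mk swap), ← seq_assoc (mk swap), hsH, seq_assoc (mk (wires 1) ⊠ mk hBox),
    swap_seq_Z, ← seq_assoc (mk hBox ⊠ mk (wires 1)) (mk (X 1 2 0) ⊠ mk (wires 1)), ← seq_par_wires, hBox_seq_X_split,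
    ← seq_assoc _ (mk (wires 1) ⊠ mk hBox) (mk (Z 2 1 4))]

end ZXClass

end Literature.Computability.QuantumComplexity


/-! ## Part: `ZXCalculusHEdge.lean` -/
/-!
# `ZX_{π/4}` modulo the calculus: the Hadamard wire between two wires; two red nodes joined by a Hadamard wire

Topic `Literature/Computability/QuantumComplexity`, continuing `ZXCalculusLadder.lean` (layer
D.4 of the formalisation of `JeandelPerdrixVilmart2018_completeness`).

The "Hadamard wire" `CZ := (Z^{(1,2)} ⊗ 𝕀) ⨾ (𝕀 ⊗ H ⊗ 𝕀) ⨾ (𝕀 ⊗ Z^{(2,1)})` (a green node on each of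
two wires, joined through a Hadamard box; semantically `CZ/√2`) and its relatives by colour change:

* the ladder rung `(X^{(1,2)} ⊗ 𝕀) ⨾ (𝕀 ⊗ Z^{(2,1)})` is `(H ⊗ 𝕀) ⨾ CZ ⨾ (H ⊗ 𝕀)` (`rung_eq_conj`), the
  CNOT shape `(Z^{(1,2)} ⊗ 𝕀) ⨾ (𝕀 ⊗ X^{(2,1)})` is `(𝕀 ⊗ H) ⨾ CZ ⨾ (𝕀 ⊗ H)` (`cnot_eq_conj`), and two
  red nodes joined by a Hadamard wire are `(H ⊗ H) ⨾ CZ ⨾ (H ⊗ H)` (`xsplits_hWire_eq_conj`);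
* hence, from (B2) in ladder layout, **the Hadamard wire is `√2 ⊗` a conjugated ladder**
  (`hWire_eq_sqrt_two_par`) and **JPV's "lemma for the equivalence (C1)"**
  (`xsplits_hWire_eq_square`): two red nodes joined by a Hadamard wire are `√2 ⊗` the green
  square with Hadamard edges crossed once,
  `CZ ⨾ σ ⨾ (H ⊗ H) ⨾ CZ` — one of the identities JPV obtain "by completeness of the
  π/2-fragment" (their figure `lemma-for-equivalence-c1`, drawn there with the crossing at the
  inputs and the first Hadamard wire as a capped pair; the crossing slides along the symmetric
  square).

## References

* E. Jeandel, S. Perdrix, R. Vilmart, LICS 2018 (arXiv:1705.11151v2) and LMCS 16(2):11 (2020),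
  proof of Lemma C1-bis ("by completeness of the π/2-fragment: `lemma-for-equivalence-c1`")
  [JeandelPerdrixVilmart2018].
-/

noncomputable section

namespace Literature.Computability.QuantumComplexity

open ZXDiagram ZXClass

namespace ZXClass

/-! ### The Hadamard wire and its colour changes -/

/-- **The ladder rung through the Hadamard wire**: `(X^{(1,2)} ⊗ 𝕀) ⨾ (𝕀 ⊗ Z^{(2,1)}) =
(H ⊗ 𝕀) ⨾ CZ ⨾ (H ⊗ 𝕀)`. [cite: JeandelPerdrixVilmart2018, Fig. 1 (H)] -/
theorem rung_eq_conj :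
    (mk (X 1 2 0) ⊠ mk (wires 1)) ⨟ (mk (wires 1) ⊠ mk (Z 2 1 0)) =
      (mk hBox ⊠ mk (wires 1)) ⨟ ((mk (Z 1 2 0) ⊠ mk (wires 1)) ⨟ ((mk (wires 1) ⊠ mk hBox) ⊠ mk (wires 1)) ⨟
        (mk (wires 1) ⊠ mk (Z 2 1 0))) ⨟ (mk hBox ⊠ mk (wires 1)) := by
  have e1 : (mk hBox ⊠ mk hBox) ⊠ mk (wires 1) = mk hBox ⊠ (mk hBox ⊠ mk (wires 1)) :=
    (par_assoc _ _ _).trans (cast_id _ _ _)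
  have e2 : (mk (wires 1) ⊠ mk hBox) ⊠ mk (wires 1) = mk (wires 1) ⊠ (mk hBox ⊠ mk (wires 1)) :=
    (par_assoc _ _ _).trans (cast_id _ _ _)
  have hL : (mk (X 1 2 0) ⊠ mk (wires 1)) ⨟ (mk (wires 1) ⊠ mk (Z 2 1 0)) =
      ((mk hBox ⊠ mk (wires 1)) ⨟ (mk (Z 1 2 0) ⊠ mk (wires 1))) ⨟ (mk hBox ⊠ ((mk hBox ⊠ mk (wires 1)) ⨟ mk (Z 2 1 0))) := by
    rw [X_split_eq, seq_par_wires (mk hBox ⨟ mk (Z 1 2 0)) (mk hBox ⊠ mk hBox) 1, seq_par_wires (mk hBox) (mk (Z 1 2 0)) 1,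
      seq_assoc, e1, interchange (mk hBox) (mk (wires 1)) (mk hBox ⊠ mk (wires 1)) (mk (Z 2 1 0)), seq_id]
  have hR : (mk hBox ⊠ mk (wires 1)) ⨟ ((mk (Z 1 2 0) ⊠ mk (wires 1)) ⨟ ((mk (wires 1) ⊠ mk hBox) ⊠ mk (wires 1)) ⨟
      (mk (wires 1) ⊠ mk (Z 2 1 0))) ⨟ (mk hBox ⊠ mk (wires 1)) =
        ((mk hBox ⊠ mk (wires 1)) ⨟ (mk (Z 1 2 0) ⊠ mk (wires 1))) ⨟ (mk hBox ⊠ ((mk hBox ⊠ mk (wires 1)) ⨟ mk (Z 2 1 0))) := by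
    rw [e2, seq_assoc (mk (Z 1 2 0) ⊠ mk (wires 1)), ← wires_par_seq, seq_assoc,
      seq_assoc (mk (Z 1 2 0) ⊠ mk (wires 1)),
      interchange (mk (wires 1)) (mk hBox) ((mk hBox ⊠ mk (wires 1)) ⨟ mk (Z 2 1 0)) (mk (wires 1)), id_seq, seq_id,
      ← seq_assoc]
  exact hL.trans hR.symm

/-- **The CNOT shape through the Hadamard wire**: `(Z^{(1,2)} ⊗ 𝕀) ⨾ (𝕀 ⊗ X^{(2,1)}) =
(𝕀 ⊗ H) ⨾ CZ ⨾ (𝕀 ⊗ H)`. [cite: JeandelPerdrixVilmart2018, Fig. 1 (H)] -/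
theorem cnot_eq_conj :
    (mk (Z 1 2 0) ⊠ mk (wires 1)) ⨟ (mk (wires 1) ⊠ mk (X 2 1 0)) =
      (mk (wires 1) ⊠ mk hBox) ⨟ ((mk (Z 1 2 0) ⊠ mk (wires 1)) ⨟ ((mk (wires 1) ⊠ mk hBox) ⊠ mk (wires 1)) ⨟
        (mk (wires 1) ⊠ mk (Z 2 1 0))) ⨟ (mk (wires 1) ⊠ mk hBox) := by
  have e1 : mk (wires 1) ⊠ (mk hBox ⊠ mk hBox) = (mk (wires 1) ⊠ mk hBox) ⊠ mk hBox :=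
    (par_assoc' _ _ _).trans (cast_id _ _ _)
  have hfront : (mk (Z 1 2 0) ⊠ mk (wires 1)) ⨟ (((mk (wires 1) ⊠ mk hBox) ⊠ mk (wires 1)) ⨟ (mk (wires (1 + 1)) ⊠ mk hBox)) =
      (mk (wires 1) ⊠ mk hBox) ⨟ ((mk (Z 1 2 0) ⊠ mk (wires 1)) ⨟ ((mk (wires 1) ⊠ mk hBox) ⊠ mk (wires 1))) := by
    rw [← seq_assoc, ← seq_par_wires, ← par_eq_seq_left, par_eq_seq_right (_ ⨟ _) (mk hBox), seq_par_wires]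
  rw [X_merge_eq, wires_par_seq, wires_par_seq, e1, par_eq_seq_left (mk (wires 1) ⊠ mk hBox) (mk hBox),
    ← seq_assoc, ← seq_assoc, hfront, seq_assoc (mk (wires 1) ⊠ mk hBox) _ (mk (wires 1) ⊠ mk (Z 2 1 0))]

/-- **Two red nodes joined by a Hadamard wire** are `(H ⊗ H) ⨾ CZ ⨾ (H ⊗ H)`. [cite: JeandelPerdrixVilmart2018, Fig. 1 (H)] -/
theorem xsplits_hWire_eq_conj :
    (mk (X 1 2 0) ⊠ mk (wires 1)) ⨟ (mk (wires 1) ⊠ ((mk hBox ⊠ mk (wires 1)) ⨟ mk (X 2 1 0))) =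
      (mk hBox ⊠ mk hBox) ⨟ ((mk (Z 1 2 0) ⊠ mk (wires 1)) ⨟ ((mk (wires 1) ⊠ mk hBox) ⊠ mk (wires 1)) ⨟
        (mk (wires 1) ⊠ mk (Z 2 1 0))) ⨟ (mk hBox ⊠ mk hBox) := by
  have hX : mk (X 1 2 0) ⨟ (mk (wires 1) ⊠ mk hBox) = mk hBox ⨟ mk (Z 1 2 0) ⨟ (mk hBox ⊠ mk (wires 1)) := by
    rw [X_split_eq, seq_assoc _ (mk hBox ⊠ mk hBox), interchange, hBox_seq_hBox, seq_id]
  have e1 : mk (wires 1) ⊠ (mk hBox ⊠ mk (wires 1)) = (mk (wires 1) ⊠ mk hBox) ⊠ mk (wires 1) :=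
    (par_assoc' _ _ _).trans (cast_id _ _ _)
  have e2 : (mk hBox ⊠ mk (wires 1)) ⊠ mk (wires 1) = mk hBox ⊠ mk (wires 2) := by
    rw [← wires_par_wires 1 1]; exact (par_assoc _ _ _).trans (cast_id _ _ _)
  rw [wires_par_seq, ← seq_assoc, e1, ← seq_par_wires, hX, seq_par_wires, seq_par_wires, e2, seq_assoc,
    ← par_eq_seq_left, par_eq_seq_right (mk hBox) (mk (X 2 1 0)), ← seq_assoc, seq_assoc (mk hBox ⊠ mk (wires 1)),
    cnot_eq_conj, ← seq_assoc, ← seq_assoc, ← par_eq_seq_left, seq_assoc, ← par_eq_seq_right]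

/-! ### The Hadamard wire from the ladder -/

/-- A scalar in front of a `2 → 2` map stays in front when a `2 → 2` map is appended. [folklore] -/
theorem scalar_par_two_two_seq_two (s : ZXClass 0 0) (A : ZXClass 2 2) (B : ZXClass 2 2) :
    (s ⊠ A) ⨟ B = s ⊠ (A ⨟ B) := by
  rw [scalar_par_seq_left, empty_par, cast_id]

/-- `(𝕀 ⊗ H) ⨾ (𝕀 ⊗ H) = 𝕀²`. [cite: JeandelPerdrixVilmart2018, Appendix Lemma 8] -/
theorem par_hBox_seq_par_hBox : (mk (wires 1) ⊠ mk hBox) ⨟ (mk (wires 1) ⊠ mk hBox) = mk (wires 2) := by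
  rw [← wires_par_seq, hBox_seq_hBox, wires_par_wires]

/-- `(H ⊗ 𝕀) ⨾ (H ⊗ 𝕀) = 𝕀²`. [cite: JeandelPerdrixVilmart2018, Appendix Lemma 8] -/
theorem hBox_par_seq_hBox_par : (mk hBox ⊠ mk (wires 1)) ⨟ (mk hBox ⊠ mk (wires 1)) = mk (wires 2) := by
  rw [← seq_par_wires, hBox_seq_hBox, wires_par_wires]

/-- **The Hadamard wire is `√2 ⊗` a ladder**: `CZ = √2 ⊗ ((𝕀 ⊗ H) ⨾ (A ⨾ σ ⨾ A) ⨾ (𝕀 ⊗ H))` with `A`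
the rung `(X^{(1,2)} ⊗ 𝕀) ⨾ (𝕀 ⊗ Z^{(2,1)})` — rule (B2) in ladder layout, colour-changed.
[cite: JeandelPerdrixVilmart2018, Fig. 1 (B2), (H)] -/
theorem hWire_eq_sqrt_two_par :
    (mk (Z 1 2 0) ⊠ mk (wires 1)) ⨟ ((mk (wires 1) ⊠ mk hBox) ⊠ mk (wires 1)) ⨟ (mk (wires 1) ⊠ mk (Z 2 1 0)) =
      mk (dumbbell 0 0) ⊠ ((mk (wires 1) ⊠ mk hBox) ⨟
        (((mk (X 1 2 0) ⊠ mk (wires 1)) ⨟ (mk (wires 1) ⊠ mk (Z 2 1 0))) ⨟ mk swap ⨟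
          ((mk (X 1 2 0) ⊠ mk (wires 1)) ⨟ (mk (wires 1) ⊠ mk (Z 2 1 0)))) ⨟ (mk (wires 1) ⊠ mk hBox)) := by
  have h := cnot_eq_conj
  rw [rule_B2_cnot] at h
  -- `h : √2 ⊗ ladder = (𝕀 ⊗ H) ⨾ CZ ⨾ (𝕀 ⊗ H)`; conjugate by `𝕀 ⊗ H`
  set cz := (mk (Z 1 2 0) ⊠ mk (wires 1)) ⨟ ((mk (wires 1) ⊠ mk hBox) ⊠ mk (wires 1)) ⨟ (mk (wires 1) ⊠ mk (Z 2 1 0))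
  rw [← scalar_par_two_two_seq_two, ← two_two_seq_scalar_par_two, h, seq_assoc (mk (wires 1) ⊠ mk hBox) _ (mk (wires 1) ⊠ mk hBox),
    seq_assoc _ (mk (wires 1) ⊠ mk hBox) (mk (wires 1) ⊠ mk hBox), par_hBox_seq_par_hBox, seq_id,
    ← seq_assoc (mk (wires 1) ⊠ mk hBox) (mk (wires 1) ⊠ mk hBox) cz, par_hBox_seq_par_hBox, id_seq]

/-- **JPV's lemma for the equivalence (C1)**: two red nodes joined by a Hadamard wire are `√2 ⊗`
the green square with Hadamard edges, crossed once:
`(X^{(1,2)} ⊗ 𝕀) ⨾ (𝕀 ⊗ ((H ⊗ 𝕀) ⨾ X^{(2,1)})) = √2 ⊗ (CZ ⨾ σ ⨾ (H ⊗ H) ⨾ CZ)`.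
[cite: JeandelPerdrixVilmart2018, proof of Lemma C1-bis (`lemma-for-equivalence-c1`)] -/
theorem xsplits_hWire_eq_square :
    (mk (X 1 2 0) ⊠ mk (wires 1)) ⨟ (mk (wires 1) ⊠ ((mk hBox ⊠ mk (wires 1)) ⨟ mk (X 2 1 0))) =
      mk (dumbbell 0 0) ⊠ (((mk (Z 1 2 0) ⊠ mk (wires 1)) ⨟ ((mk (wires 1) ⊠ mk hBox) ⊠ mk (wires 1)) ⨟ (mk (wires 1) ⊠ mk (Z 2 1 0))) ⨟
        mk swap ⨟ (mk hBox ⊠ mk hBox) ⨟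
          ((mk (Z 1 2 0) ⊠ mk (wires 1)) ⨟ ((mk (wires 1) ⊠ mk hBox) ⊠ mk (wires 1)) ⨟ (mk (wires 1) ⊠ mk (Z 2 1 0)))) := by
  have hs : (mk hBox ⊠ mk (wires 1)) ⨟ mk swap = mk swap ⨟ (mk (wires 1) ⊠ mk hBox) := by
    simpa using swap_nat (mk hBox)
  have hHH1 : (mk hBox ⊠ mk hBox) ⨟ (mk (wires 1) ⊠ mk hBox) = mk hBox ⊠ mk (wires 1) := by
    rw [interchange, hBox_seq_hBox, seq_id]
  have hHH2 : (mk (wires 1) ⊠ mk hBox) ⨟ (mk hBox ⊠ mk hBox) = mk hBox ⊠ mk (wires 1) := by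
    rw [interchange, hBox_seq_hBox, id_seq]
  -- the rung conjugated by `H ⊗ 𝕀` on either side
  have hA1 : (mk hBox ⊠ mk (wires 1)) ⨟ ((mk (X 1 2 0) ⊠ mk (wires 1)) ⨟ (mk (wires 1) ⊠ mk (Z 2 1 0))) =
      ((mk (Z 1 2 0) ⊠ mk (wires 1)) ⨟ ((mk (wires 1) ⊠ mk hBox) ⊠ mk (wires 1)) ⨟ (mk (wires 1) ⊠ mk (Z 2 1 0))) ⨟
        (mk hBox ⊠ mk (wires 1)) := by
    rw [rung_eq_conj, ← seq_assoc, ← seq_assoc, hBox_par_seq_hBox_par, id_seq]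
  have hA2 : ((mk (X 1 2 0) ⊠ mk (wires 1)) ⨟ (mk (wires 1) ⊠ mk (Z 2 1 0))) ⨟ (mk hBox ⊠ mk (wires 1)) =
      (mk hBox ⊠ mk (wires 1)) ⨟
        ((mk (Z 1 2 0) ⊠ mk (wires 1)) ⨟ ((mk (wires 1) ⊠ mk hBox) ⊠ mk (wires 1)) ⨟ (mk (wires 1) ⊠ mk (Z 2 1 0))) := by
    rw [rung_eq_conj, seq_assoc, hBox_par_seq_hBox_par, seq_id]
  set cz := (mk (Z 1 2 0) ⊠ mk (wires 1)) ⨟ ((mk (wires 1) ⊠ mk hBox) ⊠ mk (wires 1)) ⨟ (mk (wires 1) ⊠ mk (Z 2 1 0))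
  conv_lhs => rw [xsplits_hWire_eq_conj, hWire_eq_sqrt_two_par]
  rw [two_two_seq_scalar_par_two, scalar_par_two_two_seq_two]
  congr 1
  rw [← seq_assoc (mk hBox ⊠ mk hBox), ← seq_assoc (mk hBox ⊠ mk hBox), hHH1,
    seq_assoc _ (mk (wires 1) ⊠ mk hBox) (mk hBox ⊠ mk hBox), hHH2,
    ← seq_assoc (mk hBox ⊠ mk (wires 1)), ← seq_assoc (mk hBox ⊠ mk (wires 1)), hA1,
    seq_assoc _ ((mk (X 1 2 0) ⊠ mk (wires 1)) ⨟ (mk (wires 1) ⊠ mk (Z 2 1 0))) (mk hBox ⊠ mk (wires 1)), hA2,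
    seq_assoc cz (mk hBox ⊠ mk (wires 1)) (mk swap), hs, seq_assoc cz (mk swap ⨟ (mk (wires 1) ⊠ mk hBox)),
    seq_assoc (mk swap) (mk (wires 1) ⊠ mk hBox), ← seq_assoc (mk (wires 1) ⊠ mk hBox) (mk hBox ⊠ mk (wires 1)) cz,
    ← par_eq_seq_right, ← seq_assoc cz (mk swap), ← seq_assoc (cz ⨟ mk swap)]

end ZXClass

end Literature.Computability.QuantumComplexity
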